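/-
Copyright (c) 2026. All rights reserved.
Released under Apache 2.0 license as described in the file LICENSE.
-/
import Literature.NumberTheory.GaloisRepresentations.LocalFieldCdTwo
import Literature.NumberTheory.GaloisRepresentations.ContinuousH1
import HarnessLib

/-!
# `h⁰ = h¹` for finite modules over `Γ_F / Gal(F̄/F^nr) ≅ Ẑ`

Let `F` be a non-archimedean local field, `N = Gal(F̄/F^nr)` (`galUnr F`, the inertia group) and
`Q = Γ_F / N = Gal(F^nr/F)`, topologically generated by the Frobenius. For a finite discrete
`Q`-module `B` we prove **`#H¹(Q, B) = #B^Q`** (Harari, *Galois Cohomology and Class Field Theory*,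
Lemma 10.14; Serre, *Local Fields*, XIII §1; Milne, *ADT*, I §2, proof of Lemma 2.9): with
`T` the action of a Frobenius, `B^Q = ker (T - 1)` and `H¹(Q, B) ≅ B / (T - 1) B` via
`[z] ↦ z(Frobenius)`, and `#ker (T - 1) = #coker (T - 1)` for an endomorphism of a finite group.

## The argument

* A continuous cocycle on `Q` is right-invariant under an open normal subgroup `H` acting trivially,
  and `Q / H` is cyclic generated by the Frobenius (`exists_pow_eq_mk_quotient`); a cocycle
  vanishing at the Frobenius therefore vanishes (`contOneCocycles.eq_zero_of_apply_eq_zero`), which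
  gives the injectivity of `[z] ↦ z(φ) mod (T - 1) B`.
* Surjectivity: for `b₀ ∈ B` the geometric sums `S(i) = Σ_{j<i} φʲ b₀` define a cocycle on the finite
  cyclic level `Q / H₁` as soon as the norm `S(ord φ̄)` vanishes (`geomCocycle`), and it does after
  passing to the unramified level of degree `#B · n₀` (the order of `φ̄` becomes a multiple of
  `#B · n₀` while `φ^{n₀}` acts trivially).

## Main results

* `geomSum`, `geomCocycle`, `geomCocycle_apply_self`: the cocycle with prescribed value at `φ`.
* `contOneCocycles.eq_zero_of_apply_eq_zero`: a cocycle inflated from a cyclic quotient is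
  determined by its value at the generator.
* `natCard_continuousCohomology_one_quotient_galUnr`: **`#H¹(Γ_F/N, B) = #B^{Γ_F/N}`**.
-/

noncomputable section

open scoped Pointwise
open CategoryTheory Function
open Field IsNonarchimedeanLocalField ValuativeRel IntermediateField

universe u v

namespace Literature.NumberTheory.GaloisRepresentations

open _root_.TopRep _root_.ContRepresentation _root_.ContinuousCohomology DiscreteGaloisModule
open _root_.Topology _root_.Filter
open LocalWeilDatum

/-! ### Geometric sums along the powers of an element and the cocycle they define -/

section Geom

variable {R : Type u} [CommRing R] [TopologicalSpace R]
variable {G : Type v} [Group G] [TopologicalSpace G] [IsTopologicalGroup G]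
variable {X : TopRep.{v} R G} (F : G) (b₀ : X)

/-- **The geometric sums** `S(i) = Σ_{j<i} Fʲ b₀`. [cite: SerreLocalFields1979, XIII §1] -/
def geomSum (i : ℕ) : X := ∑ j ∈ Finset.range i, X.ρ (F ^ j) b₀

omit [TopologicalSpace G] [IsTopologicalGroup G] in
/-- `S(0) = 0`. [folklore] -/
@[simp] theorem geomSum_zero : geomSum F b₀ 0 = 0 := by simp [geomSum]

omit [TopologicalSpace G] [IsTopologicalGroup G] in
/-- `S(i+1) = S(i) + Fⁱ b₀`. [folklore] -/
theorem geomSum_succ (i : ℕ) : geomSum F b₀ (i + 1) = geomSum F b₀ i + X.ρ (F ^ i) b₀ := by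
  rw [geomSum, Finset.sum_range_succ]; rfl

omit [TopologicalSpace G] [IsTopologicalGroup G] in
/-- `S(1) = b₀`. [folklore] -/
@[simp] theorem geomSum_one : geomSum F b₀ 1 = b₀ := by
  rw [geomSum_succ, geomSum_zero, zero_add, pow_zero, map_one]; rfl

omit [TopologicalSpace G] [IsTopologicalGroup G] in
/-- **`S(a + b) = S(a) + Fᵃ S(b)`.** [folklore] -/
theorem geomSum_add (a b : ℕ) : geomSum F b₀ (a + b) = geomSum F b₀ a + X.ρ (F ^ a) (geomSum F b₀ b) := by
  induction b with
  | zero => rw [add_zero, geomSum_zero, map_zero, add_zero]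
  | succ b ih =>
    rw [← add_assoc, geomSum_succ, ih, geomSum_succ, map_add, add_assoc, pow_add, map_mul,
      mul_apply_eq_comp]

omit [TopologicalSpace G] [IsTopologicalGroup G] in
/-- Periodicity: if `S(n) = 0` then `S(i + n) = S(i)`. [folklore] -/
theorem geomSum_add_of_eq_zero {n : ℕ} (hN : geomSum F b₀ n = 0) (i : ℕ) :
    geomSum F b₀ (i + n) = geomSum F b₀ i := by
  rw [geomSum_add, hN, map_zero, add_zero]

omit [TopologicalSpace G] [IsTopologicalGroup G] in
/-- `S` only depends on the exponent modulo a period. [folklore] -/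
theorem geomSum_eq_of_modEq {n : ℕ} (hN : geomSum F b₀ n = 0) {i j : ℕ} (h : i ≡ j [MOD n]) :
    geomSum F b₀ i = geomSum F b₀ j := by
  have key : ∀ r k : ℕ, geomSum F b₀ (r + n * k) = geomSum F b₀ r := fun r k => by
    induction k with
    | zero => rw [mul_zero, add_zero]
    | succ k ih => rw [Nat.mul_succ, ← add_assoc, geomSum_add_of_eq_zero F b₀ hN, ih]
  rw [← Nat.mod_add_div i n, ← Nat.mod_add_div j n, key, key, h]

omit [TopologicalSpace G] [IsTopologicalGroup G] in
/-- `S(a k) = k • S(a)` when `Fᵃ` acts trivially. [folklore] -/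
theorem geomSum_mul_eq_smul {a : ℕ} (ha : ∀ x : X, X.ρ (F ^ a) x = x) (k : ℕ) :
    geomSum F b₀ (a * k) = k • geomSum F b₀ a := by
  have hak : ∀ (k : ℕ) (x : X), X.ρ (F ^ (a * k)) x = x := fun k => by
    induction k with
    | zero => intro x; rw [mul_zero, pow_zero, map_one]; rfl
    | succ k ih => intro x; rw [Nat.mul_succ, pow_add, map_mul, mul_apply_eq_comp, ha, ih]
  induction k with
  | zero => rw [mul_zero, geomSum_zero, zero_smul]
  | succ k ih => rw [Nat.mul_succ, geomSum_add, ih, hak, succ_nsmul]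

variable (H : Subgroup G) [H.Normal]
variable (hgen : ∀ q : G ⧸ H, ∃ i : ℕ, q = (QuotientGroup.mk F : G ⧸ H) ^ i)

include hgen

/-- The function `σ ↦ S(idx σ)`. [folklore] -/
def geomCocycleFun (σ : G) : X := geomSum F b₀ (idxQ H F hgen (σ : G ⧸ H))

/-- It is continuous for `H` open (it factors through the discrete quotient). [folklore] -/
theorem continuous_geomCocycleFun (hopen : IsOpen (H : Set G)) : Continuous (geomCocycleFun F b₀ H hgen) := by
  haveI : DiscreteTopology (G ⧸ H) := QuotientGroup.discreteTopology hopen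
  have hc : Continuous (fun q : G ⧸ H => geomSum F b₀ (idxQ H F hgen q)) := continuous_of_discreteTopology
  exact hc.comp QuotientGroup.continuous_mk

/-- **The cocycle `σ ↦ Σ_{j < idx σ} Fʲ b₀`** on a group with open normal `H` acting trivially and
`G / H = ⟨F̄⟩`, for `b₀` killed by the norm `Σ_{j < ord F̄} Fʲ`: the standard `1`-cocycle of the
cyclic group `G/H` with value `b₀` at the generator, inflated to `G`.
[cite: SerreLocalFields1979, XIII §1] [cite: NeukirchSchmidtWingberg2008, Ch. I §7 (1.7.1)] -/
def geomCocycle (hopen : IsOpen (H : Set G)) (hH : ∀ h ∈ H, ∀ x : X, X.ρ h x = x)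
    (hN : geomSum F b₀ (orderOf (QuotientGroup.mk F : G ⧸ H)) = 0) : contOneCocycles X :=
  ⟨⟨geomCocycleFun F b₀ H hgen, continuous_geomCocycleFun F b₀ H hgen hopen⟩, fun σ τ => by
    change geomSum F b₀ (idxQ H F hgen ((σ * τ : G) : G ⧸ H)) =
      geomSum F b₀ (idxQ H F hgen (σ : G ⧸ H)) + X.ρ σ (geomSum F b₀ (idxQ H F hgen (τ : G ⧸ H)))
    rw [geomSum_eq_of_modEq F b₀ hN (idxQ_mul_modEq H F hgen σ τ), geomSum_add]
    congr 1
    -- `σ = F^{idx σ} h` acts as `F^{idx σ}`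
    have hh := pow_idxQ_inv_mul_mem H F hgen σ
    conv_rhs => rw [show σ = F ^ idxQ H F hgen (σ : G ⧸ H) * ((F ^ idxQ H F hgen (σ : G ⧸ H))⁻¹ * σ) by
      rw [mul_inv_cancel_left]]
    rw [map_mul, mul_apply_eq_comp, hH _ hh]⟩

/-- Unfolding `geomCocycle`. [folklore] -/
theorem geomCocycle_apply (hopen : IsOpen (H : Set G)) (hH : ∀ h ∈ H, ∀ x : X, X.ρ h x = x)
    (hN : geomSum F b₀ (orderOf (QuotientGroup.mk F : G ⧸ H)) = 0) (σ : G) :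
    (geomCocycle F b₀ H hgen hopen hH hN).1 σ = geomSum F b₀ (idxQ H F hgen (σ : G ⧸ H)) := rfl

/-- **The value at `F` is `b₀`.** [folklore] -/
theorem geomCocycle_apply_self [Finite (G ⧸ H)] (hopen : IsOpen (H : Set G))
    (hH : ∀ h ∈ H, ∀ x : X, X.ρ h x = x) (hN : geomSum F b₀ (orderOf (QuotientGroup.mk F : G ⧸ H)) = 0) :
    (geomCocycle F b₀ H hgen hopen hH hN).1 F = b₀ := by
  rw [geomCocycle_apply]
  have h1 : idxQ H F hgen (F : G ⧸ H) ≡ 1 [MOD orderOf (QuotientGroup.mk F : G ⧸ H)] := by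
    rw [← pow_eq_pow_iff_modEq, pow_one]
    exact (idxQ_spec H F hgen (F : G ⧸ H)).symm
  rw [geomSum_eq_of_modEq F b₀ hN h1, geomSum_one]

omit [IsTopologicalGroup G] in
/-- **A cocycle inflated from a cyclic quotient is determined by its value at the generator**: a
continuous crossed homomorphism right-invariant under `H` with `G / H = ⟨F̄⟩` and vanishing at `F`
vanishes. [folklore] -/
theorem contOneCocycles.eq_zero_of_apply_eq_zero (w : contOneCocycles X)
    (hw : ∀ σ, ∀ h ∈ H, w.1 (σ * h) = w.1 σ) (hF : w.1 F = 0) : w = 0 := by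
  have hpow : ∀ i : ℕ, w.1 (F ^ i) = 0 := fun i => by
    induction i with
    | zero => rw [pow_zero]; exact contOneCocycles.apply_one w
    | succ i ih => rw [pow_succ, w.2, ih, hF, map_zero, zero_add]
  refine Subtype.ext (ContinuousMap.ext fun σ => ?_)
  have hh := pow_idxQ_inv_mul_mem H F hgen σ
  have := hw (F ^ idxQ H F hgen (σ : G ⧸ H)) _ hh
  rw [mul_inv_cancel_left, hpow] at this
  exact this

end Geom

/-! ### The local statement -/

section Local

variable (F : Type u) [Field F] [ValuativeRel F] [TopologicalSpace F] [IsNonarchimedeanLocalField F]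

variable {B : Type u} [AddCommGroup B] [TopologicalSpace B] [DiscreteTopology B]

/-- A continuous cocycle on `Γ_F/N` is right-invariant under an open normal subgroup acting trivially
on the finite module. [folklore] -/
theorem exists_open_normal_invariant [Finite B] (τ : ContinuousRep (absoluteGaloisGroup F ⧸ galUnr F) ℤ B)
    (w : contOneCocycles τ.toTopRep) :
    ∃ H₀ : Subgroup (absoluteGaloisGroup F ⧸ galUnr F), H₀.Normal ∧
      IsOpen (H₀ : Set (absoluteGaloisGroup F ⧸ galUnr F)) ∧
      (∀ h ∈ H₀, ∀ b : B, τ h b = b) ∧ ∀ σ, ∀ h ∈ H₀, w.1 (σ * h) = w.1 σ := by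
  haveI := absoluteGaloisGroup_compactSpace F
  set Q := absoluteGaloisGroup F ⧸ galUnr F
  let π : absoluteGaloisGroup F →ₜ* Q := ⟨QuotientGroup.mk' (galUnr F), continuous_quot_mk⟩
  let τΓ : ContinuousRep (absoluteGaloisGroup F) ℤ B := τ.restrict π
  have hker : (⋂ b : B, {σ : absoluteGaloisGroup F | τΓ σ b = b}) ∈ 𝓝 (1 : absoluteGaloisGroup F) :=
    (Filter.iInter_mem).2 fun b => τΓ.setOf_apply_eq_mem_nhds_one b
  obtain ⟨V, hV, hVw⟩ := exists_nhds_one_forall_eq' (X := absoluteGaloisGroup F) (P := absoluteGaloisGroup F)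
    (fun a v => w.1 (π (a * v))) ((w.1.continuous.comp π.continuous).comp continuous_mul)
  have h1 : (1 : absoluteGaloisGroup F) ∈ interior ((⋂ b : B, {σ : absoluteGaloisGroup F | τΓ σ b = b}) ∩ V) :=
    mem_interior_iff_mem_nhds.2 (inter_mem hker hV)
  obtain ⟨W, hW⟩ := ProfiniteGrp.exist_openNormalSubgroup_sub_open_nhds_of_one isOpen_interior h1
  have hW' : (W : Set (absoluteGaloisGroup F)) ⊆ (⋂ b : B, {σ | τΓ σ b = b}) ∩ V := hW.trans interior_subset
  let H₀ : Subgroup Q := (W : Subgroup (absoluteGaloisGroup F)).map (QuotientGroup.mk' (galUnr F))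
  haveI : H₀.Normal := Subgroup.Normal.map inferInstance _ (QuotientGroup.mk'_surjective _)
  refine ⟨H₀, inferInstance, ?_, fun h hh b => ?_, fun σ h hh => ?_⟩
  · change IsOpen ((QuotientGroup.mk' (galUnr F)) '' ((W : Subgroup (absoluteGaloisGroup F)) : Set (absoluteGaloisGroup F)))
    exact QuotientGroup.isOpenMap_coe ((W : Subgroup (absoluteGaloisGroup F)) : Set (absoluteGaloisGroup F)) W.isOpen
  · obtain ⟨v, hv, rfl⟩ := hh
    exact Set.mem_iInter.1 (hW' hv).1 b
  · obtain ⟨a, rfl⟩ := QuotientGroup.mk_surjective σ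
    obtain ⟨v, hv, rfl⟩ := hh
    have h := hVw a v (hW' hv).2
    change w.1 (π (a * v)) = w.1 (π (a * 1)) at h
    rw [mul_one, map_mul] at h
    exact h

/-- The coboundary `σ ↦ σ v - v` as a continuous crossed homomorphism. [folklore] -/
def coboundaryCocycle {G : Type u} [Group G] [TopologicalSpace G] [IsTopologicalGroup G]
    (τ : ContinuousRep G ℤ B) (v : B) : contOneCocycles τ.toTopRep :=
  ⟨⟨fun σ => τ σ v - v, (τ.continuous_apply_left v).sub continuous_const⟩, fun g h => by
    change τ (g * h) v - v = τ g v - v + τ g (τ h v - v)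
    rw [map_mul, Module.End.mul_apply, map_sub]; abel⟩

/-- Unfolding `coboundaryCocycle`. [folklore] -/
@[simp] theorem coboundaryCocycle_apply {G : Type u} [Group G] [TopologicalSpace G] [IsTopologicalGroup G]
    (τ : ContinuousRep G ℤ B) (v : B) (σ : G) : (coboundaryCocycle τ v).1 σ = τ σ v - v := rfl

/-- Its class vanishes. [folklore] -/
theorem oneCocycleClass_coboundaryCocycle {G : Type u} [Group G] [TopologicalSpace G] [IsTopologicalGroup G]
    (τ : ContinuousRep G ℤ B) (v : B) : oneCocycleClass _ (coboundaryCocycle τ v) = 0 :=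
  (oneCocycleClass_eq_zero_iff _ _).2 ⟨v, fun _ => rfl⟩

/-- **`#H¹(Γ_F/N, B) = #B^{Γ_F/N}`** for every finite discrete module `B` over
`Γ_F/N = Gal(F^nr/F)` (`N = Gal(F̄/F^nr)`): `h⁰ = h¹` for finite modules over the Galois group
of the maximal unramified extension (Harari, Lemma 10.14; Serre, *Local Fields* XIII §1 Prop. 1;
Milne, ADT I §2, proof of Lemma 2.9). [cite: SerreLocalFields1979, XIII §1 Prop. 1]
[cite: MilneADT2006, I §2 Lemma 2.9 (proof)] -/
theorem natCard_continuousCohomology_one_quotient_galUnr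
    (B : Type u) [AddCommGroup B] [TopologicalSpace B] [DiscreteTopology B] [Finite B]
    (τ : ContinuousRep (absoluteGaloisGroup F ⧸ galUnr F) ℤ B) :
    Nat.card (continuousCohomology 1 τ.toTopRep) = Nat.card τ.toTopRep.ρ.invariants := by
  classical
  haveI := absoluteGaloisGroup_compactSpace F
  set Q := absoluteGaloisGroup F ⧸ galUnr F
  let π : absoluteGaloisGroup F →ₜ* Q := ⟨QuotientGroup.mk' (galUnr F), continuous_quot_mk⟩
  -- an arithmetic Frobenius and its action
  obtain ⟨φ, hφ⟩ := exists_isFrobPow_holds (F := F) 1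
  set φQ : Q := QuotientGroup.mk φ with hφQ
  have hgen : ∀ (H : Subgroup Q) [H.Normal], IsOpen (H : Set Q) →
      ∀ r : Q ⧸ H, ∃ i : ℕ, r = (QuotientGroup.mk φQ : Q ⧸ H) ^ i :=
    fun H _ hH r => exists_pow_eq_mk_quotient F H hH hφ r
  let T : B →ₗ[ℤ] B := τ φQ
  let δ : B →+ B := (T - 1 : B →ₗ[ℤ] B).toAddMonoidHom
  have hδ : ∀ b, δ b = T b - b := fun _ => rfl
  -- an open normal subgroup acting trivially (from the zero cocycle)
  obtain ⟨H₀, hH₀n, hH₀o, hH₀X, -⟩ := exists_open_normal_invariant F τ 0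
  haveI := hH₀n
  haveI : Finite (Q ⧸ H₀) := Subgroup.quotient_finite_of_isOpen H₀ hH₀o
  -- (1) invariants `= ker (T - 1)`
  have hinv : ∀ b : B, (∀ q : Q, τ q b = b) ↔ δ b = 0 := fun b => by
    refine ⟨fun h => by rw [hδ, sub_eq_zero]; exact h φQ, fun h q => ?_⟩
    rw [hδ, sub_eq_zero] at h
    have hpow : ∀ i : ℕ, τ (φQ ^ i) b = b := fun i => by
      induction i with
      | zero => rw [pow_zero, map_one, Module.End.one_apply]
      | succ i ih => rw [pow_succ, map_mul, Module.End.mul_apply, h, ih]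
    obtain ⟨i, hi⟩ := hgen H₀ hH₀o (QuotientGroup.mk q)
    rw [← QuotientGroup.mk_pow, QuotientGroup.eq] at hi
    have : q = φQ ^ i * ((φQ ^ i)⁻¹ * q)⁻¹⁻¹ := by rw [inv_inv, mul_inv_cancel_left]
    rw [show q = φQ ^ i * (q⁻¹ * φQ ^ i)⁻¹ by rw [mul_inv_rev, inv_inv, mul_inv_cancel_left], map_mul,
      Module.End.mul_apply, hH₀X _ (H₀.inv_mem hi), hpow]
  have e_inv : τ.toTopRep.ρ.invariants ≃ δ.ker :=
    { toFun := fun v => ⟨v.1, (hinv v.1).1 fun q => v.2 q⟩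
      invFun := fun v => ⟨v.1, fun q => (hinv v.1).2 v.2 q⟩
      left_inv := fun _ => rfl
      right_inv := fun _ => rfl }
  -- (2) `#(B / im δ) = #ker δ`
  have hcount : Nat.card (B ⧸ δ.range) = Nat.card δ.ker := by
    have h1 := AddSubgroup.card_eq_card_quotient_mul_card_addSubgroup δ.range
    have h2 := AddSubgroup.card_eq_card_quotient_mul_card_addSubgroup δ.ker
    rw [Nat.card_congr (QuotientAddGroup.quotientKerEquivRange δ).toEquiv] at h2
    have hpos : 0 < Nat.card δ.range := Nat.card_pos
    rw [h2, mul_comm] at h1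
    exact (Nat.eq_of_mul_eq_mul_right hpos h1).symm
  -- (3) `H¹ ≃ B / im δ`, `[z] ↦ z(φ)`
  choose rep hrep using fun c : continuousCohomology 1 τ.toTopRep => oneCocycleClass_surjective _ c
  let f : continuousCohomology 1 τ.toTopRep → B ⧸ δ.range := fun c => QuotientAddGroup.mk ((rep c).1 φQ)
  have hf : Bijective f := by
    constructor
    · intro c d hcd
      obtain ⟨b₁, hb₁⟩ : -((rep c).1 φQ) + (rep d).1 φQ ∈ δ.range := (QuotientAddGroup.eq).1 hcd
      -- the cocycle `rep d - rep c - ∂b₁` vanishes at `φ`, hence everywhere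
      set w : contOneCocycles τ.toTopRep := rep d - rep c - coboundaryCocycle τ b₁ with hwdef
      obtain ⟨H, hHn, hHo, -, hHw⟩ := exists_open_normal_invariant F τ w
      haveI := hHn
      have hw0 : w = 0 := by
        refine contOneCocycles.eq_zero_of_apply_eq_zero φQ H (hgen H hHo) w hHw ?_
        change (rep d).1 φQ - (rep c).1 φQ - (τ φQ b₁ - b₁) = 0
        rw [← hδ, hb₁]; abel
      have : oneCocycleClass _ (rep d) - oneCocycleClass _ (rep c) = 0 := by
        rw [← oneCocycleClass_sub, show rep d - rep c = w + coboundaryCocycle τ b₁ by rw [hwdef]; abel, hw0,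
          zero_add, oneCocycleClass_coboundaryCocycle]
      rw [hrep, hrep, sub_eq_zero] at this
      exact this.symm
    · intro y
      obtain ⟨b₀, rfl⟩ := QuotientAddGroup.mk_surjective y
      -- the deeper level `H₁` at which the norm of `b₀` vanishes
      set n₀ : ℕ := orderOf (QuotientGroup.mk φQ : Q ⧸ H₀) with hn₀
      have hn₀pos : 0 < n₀ := orderOf_pos _
      set m : ℕ := Nat.card B * n₀ with hmdef
      have hm : 0 < m := Nat.mul_pos Nat.card_pos hn₀pos
      haveI := (unramifiedLevel_finite_abelian_unramified F hm).1
      haveI := (unramifiedLevel_finite_abelian_unramified F hm).2.1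
      haveI : (galFixing F (unramifiedLevel F m)).Normal := normal_galFixing _
      let H₁ : Subgroup Q := H₀ ⊓ (galFixing F (unramifiedLevel F m)).map (QuotientGroup.mk' (galUnr F))
      haveI : ((galFixing F (unramifiedLevel F m)).map (QuotientGroup.mk' (galUnr F))).Normal :=
        Subgroup.Normal.map inferInstance _ (QuotientGroup.mk'_surjective _)
      haveI : H₁.Normal := inferInstance
      have hH₁o : IsOpen (H₁ : Set Q) := by
        change IsOpen ((H₀ : Set Q) ∩ ((QuotientGroup.mk' (galUnr F)) '' (galFixing F (unramifiedLevel F m) : Set _)))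
        exact hH₀o.inter (QuotientGroup.isOpenMap_coe _ (isOpen_galFixing F _))
      have hH₁₀ : H₁ ≤ H₀ := inf_le_left
      haveI : Finite (Q ⧸ H₁) := Subgroup.quotient_finite_of_isOpen H₁ hH₁o
      set n₁ : ℕ := orderOf (QuotientGroup.mk φQ : Q ⧸ H₁) with hn₁
      have hpow₁ : φQ ^ n₁ ∈ H₁ := by
        rw [← QuotientGroup.eq_one_iff, QuotientGroup.mk_pow, hn₁]
        exact pow_orderOf_eq_one _
      have hφm : φ ^ n₁ ∈ galFixing F (unramifiedLevel F m) := by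
        have h2 : (QuotientGroup.mk (φ ^ n₁) : Q) ∈ (galFixing F (unramifiedLevel F m)).map (QuotientGroup.mk' (galUnr F)) := by
          have := hpow₁.2
          rwa [hφQ, ← QuotientGroup.mk_pow] at this
        have h3 : φ ^ n₁ ∈ ((galFixing F (unramifiedLevel F m)).map (QuotientGroup.mk' (galUnr F))).comap
            (QuotientGroup.mk' (galUnr F)) := h2
        rw [Subgroup.comap_map_eq, QuotientGroup.ker_mk',
          sup_eq_left.2 (galUnr_le_galFixing_unramifiedLevel F hm)] at h3
        exact h3
      have hmn₁ : m ∣ n₁ := by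
        have hfix : (φ ^ n₁) • rootOfUnramifiedLevel F m = rootOfUnramifiedLevel F m :=
          (mem_galFixing_iff F).1 hφm _ (IntermediateField.mem_adjoin_simple_self F _)
        exact (smul_eq_self_iff_dvd_of_isFrobPow F hm (isPrimitiveRoot_rootOfUnramifiedLevel F hm)
          (isFrobPow_pow F hφ n₁)).1 hfix
      have hn₀₁ : n₀ ∣ n₁ := by
        rw [hn₀]
        apply orderOf_dvd_of_pow_eq_one
        rw [← QuotientGroup.mk_pow, QuotientGroup.eq_one_iff]
        exact hH₁₀ hpow₁
      obtain ⟨k, hk⟩ := hn₀₁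
      have hNk : Nat.card B ∣ k := by
        have h := hmn₁
        rw [hk, hmdef, mul_comm (Nat.card B) n₀] at h
        exact Nat.dvd_of_mul_dvd_mul_left hn₀pos h
      -- the norm vanishes at level `H₁`
      have hφn₀ : ∀ x : B, τ.toTopRep.ρ (φQ ^ n₀) x = x := fun x => by
        rw [ContinuousRep.toTopRep_ρ_apply]
        refine hH₀X _ ?_ x
        rw [← QuotientGroup.eq_one_iff, QuotientGroup.mk_pow, hn₀]
        exact pow_orderOf_eq_one _
      have hN : geomSum (X := τ.toTopRep) φQ b₀ (orderOf (QuotientGroup.mk φQ : Q ⧸ H₁)) = 0 := by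
        rw [← hn₁, hk, geomSum_mul_eq_smul (X := τ.toTopRep) φQ b₀ hφn₀ k]
        obtain ⟨k', rfl⟩ := hNk
        rw [mul_comm, mul_nsmul, card_nsmul_eq_zero']
      let z : contOneCocycles τ.toTopRep := geomCocycle φQ b₀ H₁ (hgen H₁ hH₁o) hH₁o
        (fun h hh x => by rw [ContinuousRep.toTopRep_ρ_apply]; exact hH₀X h (hH₁₀ hh) x) hN
      have hz : z.1 φQ = b₀ := geomCocycle_apply_self (X := τ.toTopRep) φQ b₀ H₁ (hgen H₁ hH₁o) hH₁o _ hN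
      refine ⟨oneCocycleClass _ z, ?_⟩
      -- `rep [z] - z` is a coboundary
      have hcob : oneCocycleClass _ (rep (oneCocycleClass _ z) - z) = 0 := by
        rw [oneCocycleClass_sub, hrep, sub_self]
      obtain ⟨v, hv⟩ := (oneCocycleClass_eq_zero_iff _ _).1 hcob
      change QuotientAddGroup.mk ((rep (oneCocycleClass _ z)).1 φQ) = QuotientAddGroup.mk b₀
      rw [QuotientAddGroup.eq]
      refine ⟨-v, ?_⟩
      have h := hv φQ
      change (rep (oneCocycleClass _ z)).1 φQ - z.1 φQ = τ φQ v - v at h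
      rw [hz] at h
      rw [hδ, map_neg, ← sub_eq_zero, ← sub_eq_zero.2 h]
      abel
  rw [Nat.card_eq_of_bijective f hf, hcount, ← Nat.card_congr e_inv]

end Local

end Literature.NumberTheory.GaloisRepresentations

end
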